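import Summits.QuantumFields.YangMills.Theorems.BalabanUVNodesN22JointChartsRealU1ModelFires
import Summits.QuantumFields.YangMills.Theorems.BalabanUVNodesN22WindowedCouplingHoloOfLocalTermsRe

/-!
# BalabanUVNodes ∕ node N22 = NE9 — A6 FOR THE ANALYTIC ROAD WITHOUT THE REALITY BINDER: dag-n22-w2's ORIGINAL U(1) model (COMPLEX terms `e^{iΣ g_i ω^{k+1−i}}`, `e^{iB}`)
# carries JOINT (coupling, field) activity charts on which C6 §2 fires and `…N22WindowedCouplingHoloOfLocalTermsRe` §2 FIRES — C2's windowed coupling-holomorphy datum `hA`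
# for its localized sum — although its (2.13) terms are NOT real at real data

WIDTH SEAT dag-n22-w1 (harness re-seat g5), piece C10 of its own lineage — the A6 companion of C8 (`…N22WindowedCouplingHoloOfJointHoloRe` ∕ `…N22WindowedCouplingHoloOfLocalTermsRe`:
the reality binder of the analytic road removed).  Cell `pub-ymgap`, HUMAN RULING D-0062 (Track A) ∕ D-0149; `--kind proof --supports stmt-QuantumFields-27366 --as helper` (K3⁸
`SpineGivenEndpointR13SepCoPHV`, KEY MAP v2), COUNT-NEUTRAL.  THEOREMS ONLY (0 `def`, 0 `sorry`, standard axioms).  Imports C7 part 2 `…N22JointChartsRealU1ModelFires` (for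
`sum_histPrefix_update`, `slope_mem_Icc`, `closedBall_ofReal_subset_strip`, dag-n22-w2's model file and C6 behind it) and C8 part 2 `…LocalTermsRe` only.  Nothing re-declared.

WHY.  C7 (`…RealU1Model*`) had to replace dag-n22-w2's U(1) model (p610496 ∕ p613716: activities `A e^{−R d(Z)}·e^{iΣ g_i ω^{k+1−i}}·avg e^{−r∕w_Z} φ.1`, reading `W ↦ (b ↦ W_{b.dir}(t_b), 0)`,
chart `x ↦ ix`) by its COSINE edition because C4 §2 asked the (2.13) terms to be REAL at real data (`hIm`) — and at the U(1) model they are NOT (§1 `H_im_ne_zero_u1`).  C8 removed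
that binder (Schwarz reflection).  THIS FILE closes the loop: the ORIGINAL U(1) model, complex terms and all, carries JOINT (coupling, field) activity charts
`ℋ(τ, z) = A e^{−R d(Z)}·e^{i(a + τc)}·(1∕N)Σ e^{−r∕w_Z(t̃)} e^{i z_{l,t̃}∕w_X(t̃)}` satisfying C6 §2's three binders, and `…LocalTermsRe` §2 FIRES on it: C2's windowed coupling-holomorphy
datum `hA` holds for ITS localized sum — the analytic road's activity-level antecedent WITHOUT reality is inhabited by a model whose terms are genuinely complex.

WHAT (all [folklore]; MODEL level).  §1 (step, any weights): `norm_cexp_I_mul_le_exp_abs_im`, `cexp_I_mul_div_eq_exp_chart` (`e^{i(B·w)∕w} = exp(ρB)`), ★ `differentiable_jointChart_u1`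
(entire), ★ `norm_jointChart_u1_le` (`≤ A e^{s} e^{−R d(Z)}` on `{|Im τ| < s} × ball(0, r)`, `Z ⊆ X`, `c ∈ [0,1]`; dag-n22-w2's `norm_cexp_I_mul_div_le` + weight monotonicity), ★
`jointChart_u1_agree` (agreement at `(t, ι_X B)` with `H(Z; g; emb(e^{iB}))` for every prefix with phase `a + t·c`), `H_im_ne_zero_u1` (the U(1) activity at `(g|g_i:=s)`, unit
configuration, has NON-ZERO imaginary part whenever `sin(s ω^{k+1−i}) ≠ 0`: C4's `hIm` FAILS here).  §2 (dag-n22-w2's towers with the p. 282 tail weights): `hHolo_u1` ∕ `hBound_u1` ∕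
`hAgree_u1` = C6 §2's `hℋ ∕ hMℋ ∕ hfℋ`; ★★★ `windowedCouplingHolo_localizedSum_re_fires_u1` — C6 §2 then `…LocalTermsRe` §2 APPLY (strip `{|Im τ| < s}` conjugation-symmetric):
`∀ h ∈ Window γ, ∀ k μν z, ∀ m ≤ k, ∀ᶠ K, ∃ Fc D, holomorphic ∧ ‖Fc‖ ≤ C·e^{−δ₁|z|₁} ∧ r₀-discs ⊆ D ∧ Fc t = Π^{(K)}_{k+1}[localizedSum F S emb](h|h_m:=t; z)` with
`C = (16·(e·9·64·K₀(64,8)²·A e^{s})·B₃²∕r²)·e^{3·4M·δ₁}·K₀·K₁(4,δ₀∕2)`, under Road 1's numerals for `A e^{s}`, `2κ₀ ≤ κ ≤ r₁`, `0 ≤ r₀ < s`.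

HONEST FRAMING (binding).  An A6 MODEL WITNESS (dag-n22-w2's abelian toy on Bałaban's torus bookkeeping), count-neutral: it certifies that the reality-free antecedent of the
analytic road (C8) is inhabited by activities that read the configuration AND every young coupling and whose terms are COMPLEX at real data.  NOT NODE 00's tower, NOT the
minimizer reading, NOT print's chart `θ.ρ8`; N18's kernel step rate ∕ (1.21) existence at this model NOT claimed (C2 §1 not fired); nothing of Bałaban's asserted or constructed
([I] = CMP 109 (1987) p. 263, (1.18)–(1.21) p. 264, p. 282; [II] = CMP 116 (1988) (2.13)–(2.14) pp. 14–15, (2.38) p. 20 — TYPES only); N22 NOT discharged (typed 28∕28 · discharged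
5∕27 UNCHANGED — the chair's single count line is the only count); K3⁸ OPEN, NOT claimed, no stub touched; one finite 𝕋⁴ programme at fixed ε — R4 closes the CONDITIONAL rung
`BalabanLadder.UV` only; NOTHING about the continuum limit, ℝ⁴, OS axioms, a mass gap or the Clay problem is proved or claimed by any of this.
-/

noncomputable section

open Filter Topology Set Metric
open scoped BigOperators ComplexConjugate

namespace YMDAG.N22.JointHoloLocalTerms.U1

open Literature.MathematicalPhysics.QuantumFieldTheory.Balaban1983to89
open Literature.MathematicalPhysics.QuantumFieldTheory.Balaban1983to89.T4Continuum (T4Family)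
open Literature.MathematicalPhysics.QuantumFieldTheory.Balaban1983to89.T4OutputRate (Window)
open Literature.MathematicalPhysics.QuantumFieldTheory.Balaban1983to89.Node00 (polWindow)
open Literature.MathematicalPhysics.QuantumFieldTheory.Balaban1983to89.Node00.Sect2 (domCount domSys CPair)
open Literature.MathematicalPhysics.QuantumFieldTheory.Balaban1983to89.Node00.W1 (ClusterTower ClusterStep)
open Literature.MathematicalPhysics.QuantumFieldTheory.Balaban1983to89.Node00.U3OfKernels (histPrefix histPrefix_apply)
open Literature.MathematicalPhysics.QuantumFieldTheory.Balaban1983to89.Node00.LocalizedSum17 (localizedSum ReadingMaps)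
open Literature.MathematicalPhysics.QuantumFieldTheory.Balaban1983to89.B13Resummation (locE)
open Literature.MathematicalPhysics.QuantumFieldTheory.Balaban1983to89.B12TreeDecay (K₀ kappa₀ K₀_pos kappa₀_nonneg)
open Literature.MathematicalPhysics.QuantumFieldTheory.Balaban1983to89.B12Decay510 (delta1)
open Literature.MathematicalPhysics.QuantumFieldTheory.Balaban1983to89.B12Decay510Window (K₁)
open Literature.MathematicalPhysics.QuantumFieldTheory.Balaban1983to89.B12Decay510Torus (distCT nearT)
open Literature.MathematicalPhysics.QuantumFieldTheory.Balaban1983to89.B12Sec2to5 (l1)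
open Literature.MathematicalPhysics.QuantumFieldTheory.Balaban1983to89.TreeLengthTorus (TPt TDom)
open Literature.MathematicalPhysics.QuantumFieldTheory.Balaban1983to89.TreeLengthTorusGeometry (TTouch)
open Literature.MathematicalPhysics.QuantumFieldTheory.Balaban1983to89.B14.Eq22Determines (blockIter)
open Literature.MathematicalPhysics.QuantumFieldTheory.Balaban1983to89.B15DeterminingSets (embIter)
open YMDAG.N22.WindowSoftTwoPoint.NonzeroChart (norm_invCard_mul_sum_le_one norm_cexp_I_mul_div_le tailWeight_pos tailWeight_mono norm_ι_single_le)
open YMDAG.N22.JointHoloLocalTerms (jointCharts_of_activityJointCharts windowedCouplingHolo_localizedSum_re)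
open YMDAG.N22.JointHoloLocalTerms.RealU1 (sum_histPrefix_update slope_mem_Icc closedBall_ofReal_subset_strip)
open Literature.Analysis.Complex (isOpen_setOf_abs_im_lt)

/-! ## §1 The joint (coupling, field) chart of dag-n22-w2's U(1) model step: entire, bounded on `{|Im τ| < s} × ball(0, r)`, agreeing at real points -/

section Step

variable {P : Params} {M k : ℕ} (S : ClusterStep P ℂ M k) (wt : (domSys P M (k + 1)).Dom → Site P (k + 1) → ℝ) {A R ω r : ℝ}
variable (hS : ∀ (g : Fin (k + 1) → ℝ) (φ : CPair P ℂ) (Z : (domSys P M (k + 1)).Dom),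
  S.H g φ Z = ((A * Real.exp (-(R * (domSys P M (k + 1)).dj Z)) : ℝ) : ℂ) *
    Complex.exp (Complex.I * ((∑ i : Fin (k + 1), g i * ω ^ (k + 1 - (i : ℕ)) : ℝ) : ℂ)) *
    (((Fintype.card (Fin P.d × Site P (k + 1)) : ℂ))⁻¹ *
      ∑ lt : Fin P.d × Site P (k + 1), ((Real.exp (-(r / wt Z (blockIter (k + 1) (embIter (k + 1) lt.2)))) : ℝ) : ℂ) *
        φ.1 ⟨embIter (k + 1) lt.2, lt.1⟩))

/-- `‖e^{iζ}‖ ≤ e^{|Im ζ|}`. [folklore] -/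
theorem norm_cexp_I_mul_le_exp_abs_im (ζ : ℂ) : ‖Complex.exp (Complex.I * ζ)‖ ≤ Real.exp |ζ.im| := by
  rw [Complex.norm_exp, Complex.I_mul_re]
  exact Real.exp_le_exp.2 (neg_le_abs _)

/-- At the real point `z = B·w`: `e^{i(B·w)∕w} = e^{iB} = exp(ρ B)` for the chart `ρ = (x ↦ ix)` (`w ≠ 0`). [folklore] -/
theorem cexp_I_mul_div_eq_exp_chart (B w : ℝ) (hw : w ≠ 0) :
    Complex.exp (Complex.I * (((B : ℝ) : ℂ) * (w : ℂ)) / (w : ℂ)) = NormedSpace.exp (((ContinuousLinearMap.id ℝ ℝ).smulRight Complex.I) B) := by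
  have hw' : (w : ℂ) ≠ 0 := Complex.ofReal_ne_zero.2 hw
  rw [mul_div_assoc, mul_div_assoc, div_self hw', mul_one]
  simp only [ContinuousLinearMap.smulRight_apply, ContinuousLinearMap.id_apply, Complex.real_smul]
  rw [← congrFun Complex.exp_eq_exp_ℂ, mul_comm]

/-- ★ **THE JOINT CHART OF THE U(1) STEP IS ENTIRE** (phase `e^{i(a + τc)}`, read-outs `e^{i z_{l,t̃}∕w_X(t̃)}`: exponentials of continuous linear coordinates). [folklore] -/
theorem differentiable_jointChart_u1 (wX : Site P (k + 1) → ℝ) (Z : (domSys P M (k + 1)).Dom) (a c : ℝ) :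
    Differentiable ℂ fun p : ℂ × (Fin P.d → Site P (k + 1) → ℂ) =>
      ((A * Real.exp (-(R * (domSys P M (k + 1)).dj Z)) : ℝ) : ℂ) * Complex.exp (Complex.I * ((a : ℂ) + p.1 * (c : ℂ))) *
        (((Fintype.card (Fin P.d × Site P (k + 1)) : ℂ))⁻¹ *
          ∑ lt : Fin P.d × Site P (k + 1), ((Real.exp (-(r / wt Z (blockIter (k + 1) (embIter (k + 1) lt.2)))) : ℝ) : ℂ) *
            Complex.exp (Complex.I * p.2 lt.1 (blockIter (k + 1) (embIter (k + 1) lt.2)) / (wX (blockIter (k + 1) (embIter (k + 1) lt.2)) : ℂ))) := by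
  have hcoord : ∀ (l : Fin P.d) (t : Site P (k + 1)), Differentiable ℂ fun p : ℂ × (Fin P.d → Site P (k + 1) → ℂ) => p.2 l t := fun l t =>
    ((differentiable_apply (𝕜 := ℂ) (F' := fun _ : Site P (k + 1) => ℂ) t).comp
      (differentiable_apply (𝕜 := ℂ) (F' := fun _ : Fin P.d => Site P (k + 1) → ℂ) l)).comp differentiable_snd
  simp only [div_eq_mul_inv]
  refine ((differentiable_const _).mul (((differentiable_const _).add (differentiable_fst.mul_const _)).const_mul _).cexp).mul
    ((differentiable_const _).mul (Differentiable.fun_sum fun lt _ => (differentiable_const _).mul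
      (((hcoord lt.1 _).const_mul _).mul_const _).cexp))

/-- ★ **THE (2.38)-TYPE BOUND OF THE U(1) JOINT CHART ON `{|Im τ| < s} × ball(0, r)`** for `Z ⊆ X`, positive weights monotone in the domain, slope `c ∈ [0,1]`:
`‖chart(τ, z)‖ ≤ A·e^{s}·e^{−R d(Z)}` (`‖e^{i(a+τc)}‖ = e^{−c·Im τ} ≤ e^{s}`, and dag-n22-w2's read-out bound `‖e^{iz∕w}‖ ≤ e^{r∕w}`). [folklore] -/
theorem norm_jointChart_u1_le (hA : 0 ≤ A) (hwt : ∀ Z t, 0 < wt Z t) (hmono : ∀ (Z X : (domSys P M (k + 1)).Dom), Z.1 ⊆ X.1 → ∀ t, wt Z t ≤ wt X t)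
    {X Z : (domSys P M (k + 1)).Dom} (hZX : Z.1 ⊆ X.1) {a c s : ℝ} (hc : c ∈ Icc (0 : ℝ) 1)
    {p : ℂ × (Fin P.d → Site P (k + 1) → ℂ)} (hp : p ∈ {τ : ℂ | |τ.im| < s} ×ˢ ball (0 : Fin P.d → Site P (k + 1) → ℂ) r) :
    ‖((A * Real.exp (-(R * (domSys P M (k + 1)).dj Z)) : ℝ) : ℂ) * Complex.exp (Complex.I * ((a : ℂ) + p.1 * (c : ℂ))) *
        (((Fintype.card (Fin P.d × Site P (k + 1)) : ℂ))⁻¹ *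
          ∑ lt : Fin P.d × Site P (k + 1), ((Real.exp (-(r / wt Z (blockIter (k + 1) (embIter (k + 1) lt.2)))) : ℝ) : ℂ) *
            Complex.exp (Complex.I * p.2 lt.1 (blockIter (k + 1) (embIter (k + 1) lt.2)) / (wt X (blockIter (k + 1) (embIter (k + 1) lt.2)) : ℂ)))‖ ≤
      A * Real.exp s * Real.exp (-(R * (domSys P M (k + 1)).dj Z)) := by
  obtain ⟨hτ, hz⟩ := hp
  have hτ' : |p.1.im| < s := hτ
  have hr : 0 ≤ r := (norm_nonneg p.2).trans (mem_ball_zero_iff.1 hz).le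
  have hph : ‖Complex.exp (Complex.I * ((a : ℂ) + p.1 * (c : ℂ)))‖ ≤ Real.exp s := by
    refine (norm_cexp_I_mul_le_exp_abs_im _).trans (Real.exp_le_exp.2 ?_)
    have him : ((a : ℂ) + p.1 * (c : ℂ)).im = p.1.im * c := by simp
    rw [him, abs_mul, abs_of_nonneg hc.1]
    nlinarith [abs_nonneg p.1.im, hc.1, hc.2]
  have hread : ‖((Fintype.card (Fin P.d × Site P (k + 1)) : ℂ))⁻¹ *
      ∑ lt : Fin P.d × Site P (k + 1), ((Real.exp (-(r / wt Z (blockIter (k + 1) (embIter (k + 1) lt.2)))) : ℝ) : ℂ) *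
        Complex.exp (Complex.I * p.2 lt.1 (blockIter (k + 1) (embIter (k + 1) lt.2)) / (wt X (blockIter (k + 1) (embIter (k + 1) lt.2)) : ℂ))‖ ≤ 1 := by
    refine norm_invCard_mul_sum_le_one _ fun lt => ?_
    have hzn : ‖p.2 lt.1 (blockIter (k + 1) (embIter (k + 1) lt.2))‖ ≤ r :=
      ((norm_le_pi_norm (p.2 lt.1) _).trans (norm_le_pi_norm p.2 _)).trans (mem_ball_zero_iff.1 hz).le
    rw [norm_mul, Complex.norm_real, Real.norm_eq_abs, abs_of_pos (Real.exp_pos _)]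
    calc Real.exp (-(r / wt Z (blockIter (k + 1) (embIter (k + 1) lt.2)))) * ‖Complex.exp (Complex.I * p.2 lt.1 (blockIter (k + 1) (embIter (k + 1) lt.2)) /
            (wt X (blockIter (k + 1) (embIter (k + 1) lt.2)) : ℂ))‖
        ≤ Real.exp (-(r / wt Z (blockIter (k + 1) (embIter (k + 1) lt.2)))) * Real.exp (r / wt X (blockIter (k + 1) (embIter (k + 1) lt.2))) :=
          mul_le_mul_of_nonneg_left (norm_cexp_I_mul_div_le (hwt X _) hzn) (Real.exp_nonneg _)
      _ ≤ 1 := by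
          rw [← Real.exp_add, Real.exp_le_one_iff, neg_add_le_iff_le_add, add_zero]
          exact div_le_div_of_nonneg_left hr (hwt Z _) (hmono Z X hZX _)
  rw [norm_mul, norm_mul, Complex.norm_real, Real.norm_eq_abs, abs_of_nonneg (by positivity : 0 ≤ A * Real.exp (-(R * (domSys P M (k + 1)).dj Z)))]
  calc A * Real.exp (-(R * (domSys P M (k + 1)).dj Z)) * ‖Complex.exp (Complex.I * ((a : ℂ) + p.1 * (c : ℂ)))‖ * _
      ≤ A * Real.exp (-(R * (domSys P M (k + 1)).dj Z)) * Real.exp s * 1 := by gcongr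
    _ = A * Real.exp s * Real.exp (-(R * (domSys P M (k + 1)).dj Z)) := by ring

include hS

/-- ★ **AGREEMENT AT REAL POINTS**: at a real coupling `t` and the complexified real probe field `ι_X B = (B_{l,s}·w_X(s))` the U(1) joint chart with offset `a`, slope `c` takes
the value `H(Z; g; emb(e^{iB}))` of dag-n22-w2's U(1) activity for every prefix `g` with phase `Σ_j g_j ω^{k+1−j} = a + t·c`, `emb W = (b ↦ W_{b.dir}(t_b), 0)`. [folklore] -/
theorem jointChart_u1_agree (X : (domSys P M (k + 1)).Dom) (hwX : ∀ t, 0 < wt X t) (Z : (domSys P M (k + 1)).Dom) (g : Fin (k + 1) → ℝ) {a c : ℝ} (t : ℝ)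
    (hg : ∑ j : Fin (k + 1), g j * ω ^ (k + 1 - (j : ℕ)) = a + t * c) (Bf : Fin P.d → Site P (k + 1) → ℝ) :
    ((A * Real.exp (-(R * (domSys P M (k + 1)).dj Z)) : ℝ) : ℂ) * Complex.exp (Complex.I * ((a : ℂ) + (t : ℂ) * (c : ℂ))) *
        (((Fintype.card (Fin P.d × Site P (k + 1)) : ℂ))⁻¹ *
          ∑ lt : Fin P.d × Site P (k + 1), ((Real.exp (-(r / wt Z (blockIter (k + 1) (embIter (k + 1) lt.2)))) : ℝ) : ℂ) *
            Complex.exp (Complex.I * (fun l s => ((Bf l s : ℝ) : ℂ) * (wt X s : ℂ)) lt.1 (blockIter (k + 1) (embIter (k + 1) lt.2)) / (wt X (blockIter (k + 1) (embIter (k + 1) lt.2)) : ℂ))) =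
      S.H g ((fun b : PBond P 0 => (fun l s => NormedSpace.exp (((ContinuousLinearMap.id ℝ ℝ).smulRight Complex.I) (Bf l s))) b.dir (blockIter (k + 1) b.src)),
        fun _ => (0 : ℂ)) Z := by
  rw [hS, hg]
  congr 1
  · push_cast; ring_nf
  · congr 1
    refine Finset.sum_congr rfl fun lt _ => ?_
    congr 1
    exact cexp_I_mul_div_eq_exp_chart _ _ (hwX _).ne'

/-- THE U(1) TERMS ARE GENUINELY COMPLEX: at the zero history, the unit configuration and any polymer the activity is the POSITIVE REAL `A e^{−Rd}·avg e^{−r∕w}` times the phase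
`e^{i·0} = 1`, but one coupling update turns it by `e^{isω^{k+1−i}}` (dag-n22-w2's `H_update`) — so for `sω^{k+1−i} ∉ πℤ` the activity has NON-ZERO IMAGINARY PART whenever the read-out
is non-zero: C4's reality binder `hIm` FAILS at this model (it was the reason for the cosine edition `…RealU1Model`); after `…LocalTermsRe` it is no longer asked. [folklore] -/
theorem H_im_ne_zero_u1 [Nonempty (Fin P.d × Site P (k + 1))] (hA : 0 < A) (Z : (domSys P M (k + 1)).Dom) (i : Fin (k + 1)) {s : ℝ}
    (hsin : Real.sin (s * ω ^ (k + 1 - (i : ℕ))) ≠ 0) :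
    (S.H (Function.update (fun _ => 0) i s) ((fun _ => (1 : ℂ)), fun _ => (0 : ℂ)) Z).im ≠ 0 := by
  rw [hS]
  have hsum : ∑ j : Fin (k + 1), Function.update (fun _ : Fin (k + 1) => (0 : ℝ)) i s j * ω ^ (k + 1 - (j : ℕ)) = s * ω ^ (k + 1 - (i : ℕ)) := by
    rw [Finset.sum_eq_single i]
    · simp
    · intro j _ hj; simp [Function.update_of_ne hj]
    · intro h; exact absurd (Finset.mem_univ _) h
  rw [hsum]
  set q : ℝ := ((Fintype.card (Fin P.d × Site P (k + 1)) : ℝ))⁻¹ * (∑ lt : Fin P.d × Site P (k + 1), Real.exp (-(r / wt Z (blockIter (k + 1) (embIter (k + 1) lt.2)))))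
    with hq
  have hqC : (((Fintype.card (Fin P.d × Site P (k + 1)) : ℂ))⁻¹ *
      ∑ lt : Fin P.d × Site P (k + 1), ((Real.exp (-(r / wt Z (blockIter (k + 1) (embIter (k + 1) lt.2)))) : ℝ) : ℂ) * (1 : ℂ)) = ((q : ℝ) : ℂ) := by
    rw [hq]; push_cast; simp
  have hq0 : 0 < q := by
    rw [hq]
    exact mul_pos (inv_pos.2 (by exact_mod_cast Fintype.card_pos)) (Finset.sum_pos (fun _ _ => Real.exp_pos _) Finset.univ_nonempty)
  rw [hqC, mul_comm Complex.I, Complex.exp_mul_I]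
  simp only [Complex.mul_im, Complex.ofReal_re, Complex.ofReal_im, Complex.add_re, Complex.add_im, Complex.mul_re, Complex.I_re, Complex.I_im,
    ← Complex.ofReal_cos, ← Complex.ofReal_sin, mul_zero, mul_one, zero_mul, sub_zero, add_zero, zero_add]
  have hE : 0 < A * Real.exp (-(R * (domSys P M (k + 1)).dj Z)) := by positivity
  exact mul_ne_zero (mul_ne_zero hE.ne' hsin) hq0.ne'

end Step

/-! ## §2 AT dag-n22-w2's U(1) TOWERS: C6 §2's three activity-chart binders, C6 §2 FIRES, and `…LocalTermsRe` §2 FIRES (C2's `hA` for the localized sum — NO reality) -/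

section Tower

variable (F : T4Family) (M : ℕ) [NeZero M] (S : (K : ℕ) → ClusterTower (F.P K) ℂ M) {A R ω r δ₀ B₃ : ℝ}
variable (hS : ∀ (K k : ℕ) (g : Fin (k + 1) → ℝ) (φ : CPair (F.P K) ℂ) (Z : (domSys (F.P K) M (k + 1)).Dom),
  ((S K) k).H g φ Z = ((A * Real.exp (-(R * (domSys (F.P K) M (k + 1)).dj Z)) : ℝ) : ℂ) *
    Complex.exp (Complex.I * ((∑ i : Fin (k + 1), g i * ω ^ (k + 1 - (i : ℕ)) : ℝ) : ℂ)) *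
    (((Fintype.card (Fin (F.P K).d × Site (F.P K) (k + 1)) : ℂ))⁻¹ *
      ∑ lt : Fin (F.P K).d × Site (F.P K) (k + 1),
        ((Real.exp (-(r / (B₃ * Real.exp (-δ₀ * distCT (domCount (F.P K) M (k + 1)) M (fun i => (ZMod.cast (((blockIter (k + 1) (embIter (k + 1) lt.2))) i) : ZMod (domCount (F.P K) M (k + 1) * M))) (nearT (M := M) (fun i => (ZMod.cast (((blockIter (k + 1) (embIter (k + 1) lt.2))) i) : ZMod (domCount (F.P K) M (k + 1) * M))) Z))))) : ℝ) : ℂ) *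
        φ.1 ⟨embIter (k + 1) lt.2, lt.1⟩))

/-- `hℋ` at the U(1) towers: the joint charts are entire. [folklore] -/
theorem hHolo_u1 (γ s : ℝ) :
    ∀ (K k : ℕ), ∀ h ∈ Window γ, ∀ (m : ℕ) (X Z : (domSys (F.P K) M (k + 1)).Dom), Z.1 ⊆ X.1 →
      DifferentiableOn ℂ ((fun (K k : ℕ) (h : ℕ → ℝ) (m : ℕ) (X Z : (domSys (F.P K) M (k + 1)).Dom) (p : ℂ × (Fin (F.P K).d → Site (F.P K) (k + 1) → ℂ)) =>
        ((A * Real.exp (-(R * (domSys (F.P K) M (k + 1)).dj Z)) : ℝ) : ℂ) *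
            Complex.exp (Complex.I * (((∑ j : Fin (k + 1), histPrefix (Function.update h m 0) k j * ω ^ (k + 1 - (j : ℕ)) : ℝ) : ℂ) +
              p.1 * ((if m < k + 1 then ω ^ (k + 1 - m) else 0 : ℝ) : ℂ))) *
          (((Fintype.card (Fin (F.P K).d × Site (F.P K) (k + 1)) : ℂ))⁻¹ *
            ∑ lt : Fin (F.P K).d × Site (F.P K) (k + 1), ((Real.exp (-(r / (B₃ * Real.exp (-δ₀ * distCT (domCount (F.P K) M (k + 1)) M (fun i => (ZMod.cast (((blockIter (k + 1) (embIter (k + 1) lt.2))) i) : ZMod (domCount (F.P K) M (k + 1) * M))) (nearT (M := M) (fun i => (ZMod.cast (((blockIter (k + 1) (embIter (k + 1) lt.2))) i) : ZMod (domCount (F.P K) M (k + 1) * M))) Z))))) : ℝ) : ℂ) *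
              Complex.exp (Complex.I * p.2 lt.1 (blockIter (k + 1) (embIter (k + 1) lt.2)) / (((B₃ * Real.exp (-δ₀ * distCT (domCount (F.P K) M (k + 1)) M (fun i => (ZMod.cast (((blockIter (k + 1) (embIter (k + 1) lt.2))) i) : ZMod (domCount (F.P K) M (k + 1) * M))) (nearT (M := M) (fun i => (ZMod.cast (((blockIter (k + 1) (embIter (k + 1) lt.2))) i) : ZMod (domCount (F.P K) M (k + 1) * M))) X))) : ℝ) : ℂ)))) K k h m X Z)
        ({τ : ℂ | |τ.im| < s} ×ˢ ball (0 : Fin (F.P K).d → Site (F.P K) (k + 1) → ℂ) r) := by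
  intro K k h _ m X Z _
  let wt : (K k : ℕ) → (domSys (F.P K) M (k + 1)).Dom → Site (F.P K) (k + 1) → ℝ := fun K k X t =>
    (B₃ * Real.exp (-δ₀ * distCT (domCount (F.P K) M (k + 1)) M (fun i => (ZMod.cast ((t) i) : ZMod (domCount (F.P K) M (k + 1) * M))) (nearT (M := M) (fun i => (ZMod.cast ((t) i) : ZMod (domCount (F.P K) M (k + 1) * M))) X)))
  exact (differentiable_jointChart_u1 (A := A) (R := R) (r := r) (wt K k) (wt K k X) Z
    (∑ j : Fin (k + 1), histPrefix (Function.update h m 0) k j * ω ^ (k + 1 - (j : ℕ))) (if m < k + 1 then ω ^ (k + 1 - m) else 0)).differentiableOn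

/-- `hMℋ` at the U(1) towers with amplitude `A e^{s}` and rate `R` (`0 ≤ A`, `0 ≤ ω ≤ 1`, `δ₀ ≥ 0`, `B₃ > 0`). [folklore] -/
theorem hBound_u1 (γ s : ℝ) (hA : 0 ≤ A) (hω0 : 0 ≤ ω) (hω1 : ω ≤ 1) (hδ₀ : 0 ≤ δ₀) (hB₃ : 0 < B₃) :
    ∀ (K k : ℕ), ∀ h ∈ Window γ, ∀ (m : ℕ) (X Z : (domSys (F.P K) M (k + 1)).Dom), Z.1 ⊆ X.1 →
      ∀ p ∈ {τ : ℂ | |τ.im| < s} ×ˢ ball (0 : Fin (F.P K).d → Site (F.P K) (k + 1) → ℂ) r,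
        ‖(fun (K k : ℕ) (h : ℕ → ℝ) (m : ℕ) (X Z : (domSys (F.P K) M (k + 1)).Dom) (p : ℂ × (Fin (F.P K).d → Site (F.P K) (k + 1) → ℂ)) =>
        ((A * Real.exp (-(R * (domSys (F.P K) M (k + 1)).dj Z)) : ℝ) : ℂ) *
            Complex.exp (Complex.I * (((∑ j : Fin (k + 1), histPrefix (Function.update h m 0) k j * ω ^ (k + 1 - (j : ℕ)) : ℝ) : ℂ) +
              p.1 * ((if m < k + 1 then ω ^ (k + 1 - m) else 0 : ℝ) : ℂ))) *
          (((Fintype.card (Fin (F.P K).d × Site (F.P K) (k + 1)) : ℂ))⁻¹ *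
            ∑ lt : Fin (F.P K).d × Site (F.P K) (k + 1), ((Real.exp (-(r / (B₃ * Real.exp (-δ₀ * distCT (domCount (F.P K) M (k + 1)) M (fun i => (ZMod.cast (((blockIter (k + 1) (embIter (k + 1) lt.2))) i) : ZMod (domCount (F.P K) M (k + 1) * M))) (nearT (M := M) (fun i => (ZMod.cast (((blockIter (k + 1) (embIter (k + 1) lt.2))) i) : ZMod (domCount (F.P K) M (k + 1) * M))) Z))))) : ℝ) : ℂ) *
              Complex.exp (Complex.I * p.2 lt.1 (blockIter (k + 1) (embIter (k + 1) lt.2)) / (((B₃ * Real.exp (-δ₀ * distCT (domCount (F.P K) M (k + 1)) M (fun i => (ZMod.cast (((blockIter (k + 1) (embIter (k + 1) lt.2))) i) : ZMod (domCount (F.P K) M (k + 1) * M))) (nearT (M := M) (fun i => (ZMod.cast (((blockIter (k + 1) (embIter (k + 1) lt.2))) i) : ZMod (domCount (F.P K) M (k + 1) * M))) X))) : ℝ) : ℂ)))) K k h m X Z p‖ ≤ A * Real.exp s * Real.exp (-(R * (domSys (F.P K) M (k + 1)).dj Z)) := by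
  intro K k h _ m X Z hZX p hp
  let wt : (K k : ℕ) → (domSys (F.P K) M (k + 1)).Dom → Site (F.P K) (k + 1) → ℝ := fun K k X t =>
    (B₃ * Real.exp (-δ₀ * distCT (domCount (F.P K) M (k + 1)) M (fun i => (ZMod.cast ((t) i) : ZMod (domCount (F.P K) M (k + 1) * M))) (nearT (M := M) (fun i => (ZMod.cast ((t) i) : ZMod (domCount (F.P K) M (k + 1) * M))) X)))
  have hw0 : ∀ (X : (domSys (F.P K) M (k + 1)).Dom) (t : Site (F.P K) (k + 1)), 0 < wt K k X t := fun X t => tailWeight_pos _ X hB₃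
  have hwmono : ∀ (Z X : (domSys (F.P K) M (k + 1)).Dom), Z.1 ⊆ X.1 → ∀ t : Site (F.P K) (k + 1), wt K k Z t ≤ wt K k X t :=
    fun Z X h t => tailWeight_mono _ h hB₃.le hδ₀
  exact norm_jointChart_u1_le (wt K k) hA hw0 hwmono hZX (slope_mem_Icc hω0 hω1 k m) hp

include hS

/-- `hfℋ` at the U(1) towers: agreement at real couplings and complexified real probe fields with the activities read through dag-n22-w2's reading `emb K k W = (b ↦ W_{b.dir}(t_b), 0)`
after the chart `x ↦ ix`. [folklore] -/
theorem hAgree_u1 (γ : ℝ) (hB₃ : 0 < B₃) :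
    ∀ (K k : ℕ), ∀ h ∈ Window γ, ∀ (m : ℕ) (X Z : (domSys (F.P K) M (k + 1)).Dom), Z.1 ⊆ X.1 → ∀ t ∈ Ioc (0 : ℝ) γ,
      ∀ Bf : Fin (F.P K).d → Site (F.P K) (k + 1) → ℝ,
        (fun (K k : ℕ) (h : ℕ → ℝ) (m : ℕ) (X Z : (domSys (F.P K) M (k + 1)).Dom) (p : ℂ × (Fin (F.P K).d → Site (F.P K) (k + 1) → ℂ)) =>
        ((A * Real.exp (-(R * (domSys (F.P K) M (k + 1)).dj Z)) : ℝ) : ℂ) *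
            Complex.exp (Complex.I * (((∑ j : Fin (k + 1), histPrefix (Function.update h m 0) k j * ω ^ (k + 1 - (j : ℕ)) : ℝ) : ℂ) +
              p.1 * ((if m < k + 1 then ω ^ (k + 1 - m) else 0 : ℝ) : ℂ))) *
          (((Fintype.card (Fin (F.P K).d × Site (F.P K) (k + 1)) : ℂ))⁻¹ *
            ∑ lt : Fin (F.P K).d × Site (F.P K) (k + 1), ((Real.exp (-(r / (B₃ * Real.exp (-δ₀ * distCT (domCount (F.P K) M (k + 1)) M (fun i => (ZMod.cast (((blockIter (k + 1) (embIter (k + 1) lt.2))) i) : ZMod (domCount (F.P K) M (k + 1) * M))) (nearT (M := M) (fun i => (ZMod.cast (((blockIter (k + 1) (embIter (k + 1) lt.2))) i) : ZMod (domCount (F.P K) M (k + 1) * M))) Z))))) : ℝ) : ℂ) *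
              Complex.exp (Complex.I * p.2 lt.1 (blockIter (k + 1) (embIter (k + 1) lt.2)) / (((B₃ * Real.exp (-δ₀ * distCT (domCount (F.P K) M (k + 1)) M (fun i => (ZMod.cast (((blockIter (k + 1) (embIter (k + 1) lt.2))) i) : ZMod (domCount (F.P K) M (k + 1) * M))) (nearT (M := M) (fun i => (ZMod.cast (((blockIter (k + 1) (embIter (k + 1) lt.2))) i) : ZMod (domCount (F.P K) M (k + 1) * M))) X))) : ℝ) : ℂ)))) K k h m X Z
            ((t : ℂ), (fun (K k : ℕ) (X : (domSys (F.P K) M (k + 1)).Dom) => (LinearMap.toContinuousLinearMap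
      { toFun := fun B : Fin (F.P K).d → Site (F.P K) (k + 1) → ℝ => fun l t => ((B l t : ℝ) : ℂ) * (((B₃ * Real.exp (-δ₀ * distCT (domCount (F.P K) M (k + 1)) M (fun i => (ZMod.cast ((t) i) : ZMod (domCount (F.P K) M (k + 1) * M))) (nearT (M := M) (fun i => (ZMod.cast ((t) i) : ZMod (domCount (F.P K) M (k + 1) * M))) X))) : ℝ) : ℂ)
        map_add' := fun B B' => by funext l t; simp only [Pi.add_apply]; push_cast; ring
        map_smul' := fun c B => by funext l t; simp only [Pi.smul_apply, smul_eq_mul, RingHom.id_apply, Complex.real_smul]; push_cast; ring } :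
      (Fin (F.P K).d → Site (F.P K) (k + 1) → ℝ) →L[ℝ] (Fin (F.P K).d → Site (F.P K) (k + 1) → ℂ))) K k X Bf) =
          ((S K) k).H (histPrefix (Function.update h m t) k)
            ((fun (K k : ℕ) (W : Fin (F.P K).d → Site (F.P K) (k + 1) → ℂ) => (((fun b : PBond (F.P K) 0 => W b.dir (blockIter (k + 1) b.src)), fun _ => (0 : ℂ)) : CPair (F.P K) ℂ)) K k
              (fun l u => NormedSpace.exp (((ContinuousLinearMap.id ℝ ℝ).smulRight Complex.I) (Bf l u)))) Z := by
  intro K k h _ m X Z _ t _ Bf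
  let wt : (K k : ℕ) → (domSys (F.P K) M (k + 1)).Dom → Site (F.P K) (k + 1) → ℝ := fun K k X t =>
    (B₃ * Real.exp (-δ₀ * distCT (domCount (F.P K) M (k + 1)) M (fun i => (ZMod.cast ((t) i) : ZMod (domCount (F.P K) M (k + 1) * M))) (nearT (M := M) (fun i => (ZMod.cast ((t) i) : ZMod (domCount (F.P K) M (k + 1) * M))) X)))
  have hw0 : ∀ (X : (domSys (F.P K) M (k + 1)).Dom) (t : Site (F.P K) (k + 1)), 0 < wt K k X t := fun X t => tailWeight_pos _ X hB₃
  rw [LinearMap.coe_toContinuousLinearMap']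
  exact jointChart_u1_agree ((S K) k) (wt K k) (hS K k) X (hw0 X) Z _ t (sum_histPrefix_update ω h k m t) Bf

open Classical in
/-- ★★★ **`…LocalTermsRe` §2 FIRES AT dag-n22-w2's U(1) MODEL — C2's WINDOWED COUPLING-HOLOMORPHY DATUM `hA` FOR ITS LOCALIZED SUM, WITH COMPLEX TERMS.**  For `M = L^{m′}`, towers
`S` whose activities ARE the U(1) display (p610496 ∕ p613716), window `γ > 0`, field radius = the read-out letter `r > 0`, tails `δ₀ > 0`, `B₃ > 0`, `0 ≤ A`, `0 ≤ ω ≤ 1`, soft-sum rate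
`2κ₀(64,8) ≤ κ ≤ r₁`, Road 1's numerals for `A e^{s}`, disc radius `0 ≤ r₀ < s`: C6 §2 turns the joint activity charts (§2 `hHolo ∕ hBound ∕ hAgree_u1`) into per-term joint OUTPUT
charts, and `windowedCouplingHolo_localizedSum_re` — whose coupling domain `{|Im τ| < s}` is conjugation-symmetric and which asks NO reality — APPLIES: `∀ h ∈ Window γ, ∀ k μν z,
∀ m ≤ k, ∀ᶠ K, ∃ Fc D, holomorphic ∧ ‖Fc‖ ≤ C·e^{−δ₁|z|₁} ∧ r₀-discs ⊆ D ∧ Fc t = Π^{(K)}_{k+1}[localizedSum F S emb](h|h_m:=t; z)`.  At this model C4's `hIm` is FALSE (§1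
`H_im_ne_zero_u1`) — the binder removed by C8 was a genuine restriction.  MODEL witness (declared): NOT NODE 00's towers. [folklore] -/
theorem windowedCouplingHolo_localizedSum_re_fires_u1 (m' : ℕ) (hM : M = F.L ^ m') {γ κ s r₀ r₁ : ℝ} (hγ : 0 < γ) (hr : 0 < r)
    (hκ₀ : kappa₀ (4 * 2 ^ 4) (2 * 4) ≤ κ / 2) (hδ₀ : 0 < δ₀) (hB₃ : 0 < B₃) (hA : 0 ≤ A) (hω0 : 0 ≤ ω) (hω1 : ω ≤ 1) (hκE : κ ≤ r₁)
    (hr₁ : 0 ≤ r₁) (hrate : r₁ + 2 * (64 * Real.log 162) + 2 ≤ R) (hsmall : A * Real.exp s * Real.exp (5 * r₁ + 1) * K₀ 64 8 * 9 * 64 ≤ 1)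
    (hr₀ : 0 ≤ r₀) (hr₀s : r₀ < s) :
    ∀ h ∈ Window γ, ∀ (k : ℕ) (μ ν : Fin 4) (z : Fin 4 → ℤ) (m : ℕ), m < k + 1 → ∀ᶠ K in atTop,
      ∃ (Fc : ℂ → ℂ) (D : Set ℂ), DifferentiableOn ℂ Fc D ∧
        (∀ w' ∈ D, ‖Fc w'‖ ≤ (16 * (Real.exp 1 * 9 * 64 * K₀ 64 8 ^ 2 * (A * Real.exp s)) * B₃ ^ 2 / r ^ 2) *
            Real.exp (delta1 δ₀ κ ((M : ℝ) * 4) * ((M : ℝ) * 4) * 3) * K₀ (4 * 2 ^ 4) (2 * 4) * K₁ 4 (δ₀ / 2) * Real.exp (-(delta1 δ₀ κ ((M : ℝ) * 4) * l1 z))) ∧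
        (∀ t ∈ Ioc (0 : ℝ) γ, closedBall (t : ℂ) r₀ ⊆ D) ∧
        (∀ t ∈ Ioc (0 : ℝ) γ, Fc t = (polWindow F K (k + 1) (localizedSum F S
            (fun (K k : ℕ) (W : Fin (F.P K).d → Site (F.P K) (k + 1) → ℂ) => (((fun b : PBond (F.P K) 0 => W b.dir (blockIter (k + 1) b.src)), fun _ => (0 : ℂ)) : CPair (F.P K) ℂ))
            k (histPrefix (Function.update h m t) k) K) ((ContinuousLinearMap.id ℝ ℝ).smulRight Complex.I) (Module.Basis.singleton Unit ℝ) μ ν z : ℂ)) := by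
  have hA' : 0 ≤ A * Real.exp s := by positivity
  obtain ⟨h𝒢, hM𝒢, hf⟩ := jointCharts_of_activityJointCharts F S
    (fun (K k : ℕ) (W : Fin (F.P K).d → Site (F.P K) (k + 1) → ℂ) => (((fun b : PBond (F.P K) 0 => W b.dir (blockIter (k + 1) b.src)), fun _ => (0 : ℂ)) : CPair (F.P K) ℂ))
    ((ContinuousLinearMap.id ℝ ℝ).smulRight Complex.I) hA' hr₁ hrate hsmall
    (fun K k => Fin (F.P K).d → Site (F.P K) (k + 1) → ℂ)
    (fun (K k : ℕ) (X : (domSys (F.P K) M (k + 1)).Dom) => (LinearMap.toContinuousLinearMap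
      { toFun := fun B : Fin (F.P K).d → Site (F.P K) (k + 1) → ℝ => fun l t => ((B l t : ℝ) : ℂ) * (((B₃ * Real.exp (-δ₀ * distCT (domCount (F.P K) M (k + 1)) M (fun i => (ZMod.cast ((t) i) : ZMod (domCount (F.P K) M (k + 1) * M))) (nearT (M := M) (fun i => (ZMod.cast ((t) i) : ZMod (domCount (F.P K) M (k + 1) * M))) X))) : ℝ) : ℂ)
        map_add' := fun B B' => by funext l t; simp only [Pi.add_apply]; push_cast; ring
        map_smul' := fun c B => by funext l t; simp only [Pi.smul_apply, smul_eq_mul, RingHom.id_apply, Complex.real_smul]; push_cast; ring } :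
      (Fin (F.P K).d → Site (F.P K) (k + 1) → ℝ) →L[ℝ] (Fin (F.P K).d → Site (F.P K) (k + 1) → ℂ)))
    (isOpen_setOf_abs_im_lt s)
    (fun (K k : ℕ) (h : ℕ → ℝ) (m : ℕ) (X Z : (domSys (F.P K) M (k + 1)).Dom) (p : ℂ × (Fin (F.P K).d → Site (F.P K) (k + 1) → ℂ)) =>
        ((A * Real.exp (-(R * (domSys (F.P K) M (k + 1)).dj Z)) : ℝ) : ℂ) *
            Complex.exp (Complex.I * (((∑ j : Fin (k + 1), histPrefix (Function.update h m 0) k j * ω ^ (k + 1 - (j : ℕ)) : ℝ) : ℂ) +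
              p.1 * ((if m < k + 1 then ω ^ (k + 1 - m) else 0 : ℝ) : ℂ))) *
          (((Fintype.card (Fin (F.P K).d × Site (F.P K) (k + 1)) : ℂ))⁻¹ *
            ∑ lt : Fin (F.P K).d × Site (F.P K) (k + 1), ((Real.exp (-(r / (B₃ * Real.exp (-δ₀ * distCT (domCount (F.P K) M (k + 1)) M (fun i => (ZMod.cast (((blockIter (k + 1) (embIter (k + 1) lt.2))) i) : ZMod (domCount (F.P K) M (k + 1) * M))) (nearT (M := M) (fun i => (ZMod.cast (((blockIter (k + 1) (embIter (k + 1) lt.2))) i) : ZMod (domCount (F.P K) M (k + 1) * M))) Z))))) : ℝ) : ℂ) *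
              Complex.exp (Complex.I * p.2 lt.1 (blockIter (k + 1) (embIter (k + 1) lt.2)) / (((B₃ * Real.exp (-δ₀ * distCT (domCount (F.P K) M (k + 1)) M (fun i => (ZMod.cast (((blockIter (k + 1) (embIter (k + 1) lt.2))) i) : ZMod (domCount (F.P K) M (k + 1) * M))) (nearT (M := M) (fun i => (ZMod.cast (((blockIter (k + 1) (embIter (k + 1) lt.2))) i) : ZMod (domCount (F.P K) M (k + 1) * M))) X))) : ℝ) : ℂ))))
    (hHolo_u1 F M γ s) (hBound_u1 F M γ s hA hω0 hω1 hδ₀.le hB₃) (hAgree_u1 F M S hS γ hB₃)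
  have hB : 0 ≤ Real.exp 1 * 9 * 64 * K₀ 64 8 ^ 2 * (A * Real.exp s) := by have := K₀_pos 64 8; positivity
  refine windowedCouplingHolo_localizedSum_re F m' M hM S
    (fun (K k : ℕ) (W : Fin (F.P K).d → Site (F.P K) (k + 1) → ℂ) => (((fun b : PBond (F.P K) 0 => W b.dir (blockIter (k + 1) b.src)), fun _ => (0 : ℂ)) : CPair (F.P K) ℂ))
    ((ContinuousLinearMap.id ℝ ℝ).smulRight Complex.I) (Module.Basis.singleton Unit ℝ) hγ hr hκ₀ hδ₀ hB₃.le hB hκE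
    (fun K k => Fin (F.P K).d → Site (F.P K) (k + 1) → ℂ)
    (fun (K k : ℕ) (X : (domSys (F.P K) M (k + 1)).Dom) => (LinearMap.toContinuousLinearMap
      { toFun := fun B : Fin (F.P K).d → Site (F.P K) (k + 1) → ℝ => fun l t => ((B l t : ℝ) : ℂ) * (((B₃ * Real.exp (-δ₀ * distCT (domCount (F.P K) M (k + 1)) M (fun i => (ZMod.cast ((t) i) : ZMod (domCount (F.P K) M (k + 1) * M))) (nearT (M := M) (fun i => (ZMod.cast ((t) i) : ZMod (domCount (F.P K) M (k + 1) * M))) X))) : ℝ) : ℂ)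
        map_add' := fun B B' => by funext l t; simp only [Pi.add_apply]; push_cast; ring
        map_smul' := fun c B => by funext l t; simp only [Pi.smul_apply, smul_eq_mul, RingHom.id_apply, Complex.real_smul]; push_cast; ring } :
      (Fin (F.P K).d → Site (F.P K) (k + 1) → ℝ) →L[ℝ] (Fin (F.P K).d → Site (F.P K) (k + 1) → ℂ)))
    (isOpen_setOf_abs_im_lt s) (fun τ hτ => by simpa [Complex.conj_im, abs_neg] using hτ) (fun t _ => closedBall_ofReal_subset_strip t hr₀s) hr₀
    (fun (K k : ℕ) (h : ℕ → ℝ) (m : ℕ) (X : (domSys (F.P K) M (k + 1)).Dom) (p : ℂ × (Fin (F.P K).d → Site (F.P K) (k + 1) → ℂ)) =>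
      locE (TTouch (d := 4) (N := domCount (F.P K) M (k + 1))) (fun Z : (domSys (F.P K) M (k + 1)).Dom => Z.1)
        (fun Z => (fun (K k : ℕ) (h : ℕ → ℝ) (m : ℕ) (X Z : (domSys (F.P K) M (k + 1)).Dom) (p : ℂ × (Fin (F.P K).d → Site (F.P K) (k + 1) → ℂ)) =>
        ((A * Real.exp (-(R * (domSys (F.P K) M (k + 1)).dj Z)) : ℝ) : ℂ) *
            Complex.exp (Complex.I * (((∑ j : Fin (k + 1), histPrefix (Function.update h m 0) k j * ω ^ (k + 1 - (j : ℕ)) : ℝ) : ℂ) +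
              p.1 * ((if m < k + 1 then ω ^ (k + 1 - m) else 0 : ℝ) : ℂ))) *
          (((Fintype.card (Fin (F.P K).d × Site (F.P K) (k + 1)) : ℂ))⁻¹ *
            ∑ lt : Fin (F.P K).d × Site (F.P K) (k + 1), ((Real.exp (-(r / (B₃ * Real.exp (-δ₀ * distCT (domCount (F.P K) M (k + 1)) M (fun i => (ZMod.cast (((blockIter (k + 1) (embIter (k + 1) lt.2))) i) : ZMod (domCount (F.P K) M (k + 1) * M))) (nearT (M := M) (fun i => (ZMod.cast (((blockIter (k + 1) (embIter (k + 1) lt.2))) i) : ZMod (domCount (F.P K) M (k + 1) * M))) Z))))) : ℝ) : ℂ) *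
              Complex.exp (Complex.I * p.2 lt.1 (blockIter (k + 1) (embIter (k + 1) lt.2)) / (((B₃ * Real.exp (-δ₀ * distCT (domCount (F.P K) M (k + 1)) M (fun i => (ZMod.cast (((blockIter (k + 1) (embIter (k + 1) lt.2))) i) : ZMod (domCount (F.P K) M (k + 1) * M))) (nearT (M := M) (fun i => (ZMod.cast (((blockIter (k + 1) (embIter (k + 1) lt.2))) i) : ZMod (domCount (F.P K) M (k + 1) * M))) X))) : ℝ) : ℂ)))) K k h m X Z p) X.1)
    h𝒢 hM𝒢 hf
    (fun (K k : ℕ) (X : (domSys (F.P K) M (k + 1)).Dom) (t : Site (F.P K) (k + 1)) => (B₃ * Real.exp (-δ₀ * distCT (domCount (F.P K) M (k + 1)) M (fun i => (ZMod.cast ((t) i) : ZMod (domCount (F.P K) M (k + 1) * M))) (nearT (M := M) (fun i => (ZMod.cast ((t) i) : ZMod (domCount (F.P K) M (k + 1) * M))) X))))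
    (fun K k X t => (tailWeight_pos _ X hB₃).le) ?_ (fun K k X t => le_rfl)
  intro K k X l t c
  rw [LinearMap.coe_toContinuousLinearMap']
  exact norm_ι_single_le _ (fun t => (tailWeight_pos _ X hB₃).le) l t c

end Tower

end YMDAG.N22.JointHoloLocalTerms.U1

end
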